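import Literature.Computability.QuantumComplexity.SignedCubicForrelation
import Literature.Computability.QuantumComplexity.ForrelationMSubspaceDuality
import Literature.Computability.QuantumComplexity.CubicForrelationEstimatorAnalysis
import Literature.Computability.Complexity.PromiseBPPFromFPDecider
import Literature.Computability.Complexity.F2RowReduction
import Literature.Computability.Complexity.StackLists
import Literature.Computability.Complexity.SumcheckMAReferee
import Literature.Computability.QuantumComplexity.SymExecCodeFP

/-!
# Stub `stub_plumbing` of line `dual-pingpong-frame` (crux stmt-QuantumAdvantage-13932): the `FP` decider

Support file (`--supports stmt-QuantumAdvantage-13932`) for the refutation skeleton of crux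
`Summit.QuantumAdvantage.QuantumAdvantage.Theses.CubicForrelation.SignedExactCubicForrelationNotPrBPP`
(route `QuantumAdvantage/CubicForrelation`, line `dual-pingpong-frame`). It proves the registered stub
`stub_plumbing : PairFinderExact → SignReadout → signedExactCubicForrelationProblem 2 ∈ PromiseBPP'` — the
machine-level plumbing of the line, whose mathematics is closed: GIVEN a polynomial-time finder returning, on
every exact cubic pair `(f, g) = (C₀, C₁)` (`k = 2`, `n` even, `B₂`-circuits of degree `≤ 3`, `Φ = ±1`), the rows
of an M-subspace `V` of `g` (`0 ∈ V`, `⊕`-closed, `|V|² = 2ⁿ`, second derivatives of `g` along `V` vanish), and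
GIVEN the sign readout `Φ = (-1)^{f(0)} (-1)^{g(μ)}` for any slope `μ` of `f` on `V^⊥`, the signed exact slice
(`SignedCubicForrelation.lean`) is in textbook promise-`BPP` (`Promise.lean`, Goldreich 2006 Def. 1.2).

**The machine** (`Plumbing.accept`; deterministic — the coins are not read). On `⟨x, y⟩` with
`x = encode (n, k, C₀, C₁)`: rows `L := decNil (find x)` (total decoding of the finder's list code); the reduced
echelon form `S := F2Elim.rrun n L` over `𝔽₂` (`F2RowReduction.lean`), whose kernel vectors `x_c`
(`F2Elim.kvec`, `c` a free column) span `ker L = V^⊥`; the slope vector `μ` (`Plumbing.muOf`): `μ_c := f(x_c) ⊕ f(0)`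
at free `c`, `0` at pivot columns — since `(x_c)_i = δ_{ci}` on free coordinates, `μ` solves the basis equations
`x_c · μ = f(x_c) ⊕ f(0)` with no second elimination; ACCEPT iff `f(0) = g(μ)` (`Plumbing.acceptCore`). The
dimension used is `min n (|x| + 1)` (`CubicDequant.nEff`), so the function is polynomial time on ALL inputs
(`acceptI_codeFP`, assembled from the typed `CodeFP` kits: `ForrelationCircuitCode` parsing and `evalP`,
`F2Elim.rrun/kvec/isPiv_codeFP`, `SumcheckMA.decNilC`, `BravyiGosset.bitsOfStr`); on the promise the
truncation is idle (`n_le_of_value`: `Φ = ±1` leaves at most one idle input wire, by `ForrMem.value_eq`).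
The `FP` witness `dec` and its one-bit normalisation follow `CubicForrelationEstimatorMachine.lean`.

**Correctness** (`accept_eq_true_iff`). `V^⊥ = ker L` (`perp_iff_kerSet`, via `twist = sgnZ ∘ dotZ`);
McFarland duality for exact pairs (`DerivativeWalsh.dual_affine_on_perp_cosets`, landed) gives a slope `r` of
`f` on `V^⊥`; both `r` and `μ` solve the basis equations and `V^⊥` is spanned by the `x_c` (K1/K2 of
`F2RowReduction.lean`), so `x · μ = x · r` on `V^⊥` (`slope_muOf`) and the readout applies to `μ`:
`Φ = (-1)^{f 0}(-1)^{g μ}`, i.e. `accept ↔ Φ = 1`. Hence yes-codes are accepted and no-codes rejected for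
every coin string (`uniformProb = 1`), and `PromiseProblem.mem_PromiseBPP'_of_fp_decider` concludes.

Not here: the finder (`stub_finder`, open) and the readout (`stub_signReadout`) — they are the two hypotheses.

## References

* [Goldreich2006] O. Goldreich, *On promise problems: a survey*, LNCS 3895 (2006), Def. 1.2 (promise-BPP).
* [AaronsonAmbainis2018] S. Aaronson, A. Ambainis, *Forrelation*, SIAM J. Comput. 47 (2018), §1.1.1, §3.2, §6.
* [Carlet2020] C. Carlet, *Boolean Functions for Cryptography and Coding Theory*, CUP 2021, Prop. 54, Prop. 77.
* [KnuthTAOCP2] D. E. Knuth, *TAOCP* Vol. 2, 3rd ed., §4.6.2 Algorithm N (null space by column reduction).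
* [AroraBarak2009] S. Arora, B. Barak, *Computational Complexity*, CUP 2009, §1.3 (polynomial time), Def. 7.3.
-/

noncomputable section

set_option linter.dupNamespace false -- D-0017: single-problem summit ⇒ `QuantumAdvantage.QuantumAdvantage` by design

namespace Summit.QuantumAdvantage.QuantumAdvantage.Theorems.SignedExactCubicForrelationNotPrBPP

open Finset
open Literature.Computability.Complexity Literature.Computability.QuantumComplexity
open Literature.Computability.QuantumComplexity.BuzetChailloux (bxor zeroVec)

namespace Plumbing

open _root_.Computability Literature.Computability.Complexity.CodeFP Literature.Computability.Complexity.Brick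
open ForrCode CubicDequant
open Literature.Computability.Complexity.F2Elim (bitsE stCE Row rrun kvec isPiv)

/-! ### The decision as a plain function -/

/-- The slope bit of the circuit (code) `c₀` at `v`: `c₀(v) ⊕ c₀(0)` (the empty input reads as `0ⁿ`). [folklore] -/
def slopeBit (c₀ : PCirc) (v : List Bool) : Bool := (evalP c₀ v ^^ evalP c₀ [])

/-- **The slope vector** `μ ∈ {0,1}ⁿ` read off the reduced form `S` of the rows: `μ_c = c₀(x_c) ⊕ c₀(0)` at every FREE
column `c` (`x_c = kvec n S c` the kernel vector attached to `c`), `μ_c = 0` at pivot columns. Since `(x_f)_c = δ_{fc}` on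
free columns, `μ · x_f = μ_f`: `μ` solves the basis equations `μ · x_f = c₀(x_f) ⊕ c₀(0)`. [cite: KnuthTAOCP2, §4.6.2 Algorithm N] -/
def muOf (n : ℕ) (c₀ : PCirc) (S : List Row) : List Bool :=
  (List.range n).map fun c => !isPiv S c && slopeBit c₀ (kvec n S c)

/-- **The core decision** on `n`, the two circuit codes and the rows: accept iff `c₀(0) = c₁(μ)` for the slope vector
`μ` of the reduced form of the rows. [cite: AaronsonAmbainis2018, §1.1.1] -/
def acceptCore (n : ℕ) (c₀ c₁ : PCirc) (rows : List (List Bool)) : Bool :=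
  !(evalP c₀ [] ^^ evalP c₁ (muOf n c₀ (rrun n rows)))

/-- **The decision** on the mirror instance `t = (n, k, circuits)` and the instance code `x` itself (the coins are not
read): rows `:= decNil (find x)`, effective dimension `nEff t |x| = min n (|x| + 1)` (`= n` on the promise), circuits
`0` and `1`. [cite: AaronsonAmbainis2018, §1.1.1] -/
def accept (find : List Bool → List Bool) (t : Inst) (x : List Bool) : Bool :=
  acceptCore (nEff t x.length) (circAt t 0) (circAt t 1) (decNil (find x))

/-! ### Polynomial time -/

/-- The code of the core context `((n, (c₀, c₁)), rows)` (`n` unary, rows as raw strings). [folklore] -/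
abbrev CE : (ℕ × (PCirc × PCirc)) × List (List Bool) → List Bool := pairE (pairE unE (pairE pcE pcE)) (rawE strE)

/-- The slope bit on codes: `(c₀, v) ↦ slopeBit c₀ v` (`v` a raw bit list). [cite: AroraBarak2009, §1.3] -/
theorem slopeBit_codeFP : CodeFP (pairE pcE bitsE) bitE (fun t => slopeBit t.1 t.2) :=
  ((evalP_codeFP.comp ((fst _ _).pair (bitsToStr.comp (snd _ _)))).xor
    (evalP_codeFP.comp ((fst _ _).pair (const _ ([] : List Bool))))).congr fun _ => rfl

/-- The slope vector on codes: `((n, c₀), S) ↦ muOf n c₀ S`. [cite: AroraBarak2009, §1.3] -/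
theorem muOf_codeFP : CodeFP (pairE (pairE unE pcE) stCE) bitsE (fun q => muOf q.1.1 q.1.2 q.2) := by
  have hg : CodeFP (pairE (pairE (pairE unE pcE) stCE) natE) bitE
      (fun t => !isPiv t.1.2 t.2 && slopeBit t.1.1.2 (kvec t.1.1.1 t.1.2 t.2)) :=
    (F2Elim.isPiv_codeFP.comp ((snd _ _).pair (fst _ _).snd')).not.and
      (slopeBit_codeFP.comp ((fst _ _).fst'.snd'.pair (F2Elim.kvec_codeFP.comp ((((fst _ _).fst'.fst').pair (snd _ _)).pair (fst _ _).snd'))))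
  have hm := CodeFP.map (σ := (ℕ × PCirc) × List Row) (eσ := pairE (pairE unE pcE) stCE) (eα := natE) (eβ := bitE)
    (g := fun t => !isPiv t.1.2 t.2 && slopeBit t.1.1.2 (kvec t.1.1.1 t.1.2 t.2)) hg
  exact (hm.comp ((CodeFP.id _).pair (urange.comp (fst _ _).fst'))).congr fun _ => rfl

/-- **The core decision on codes.** [cite: AroraBarak2009, §1.3] -/
theorem acceptCore_codeFP : CodeFP CE bitE (fun q => acceptCore q.1.1 q.1.2.1 q.1.2.2 q.2) := by
  have hn : CodeFP CE unE (fun q => q.1.1) := (fst _ _).fst'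
  have hc0 : CodeFP CE pcE (fun q => q.1.2.1) := (fst _ _).snd'.fst'
  have hc1 : CodeFP CE pcE (fun q => q.1.2.2) := (fst _ _).snd'.snd'
  have hrows : CodeFP CE (rawE bitsE) (fun q => q.2) := ((map₀ BravyiGosset.bitsOfStr).comp (snd _ _)).congr fun q => List.map_id _
  have hS : CodeFP CE stCE (fun q => rrun q.1.1 q.2) := F2Elim.rrun_codeFP.comp (hn.pair hrows)
  have hmu : CodeFP CE bitsE (fun q => muOf q.1.1 q.1.2.1 (rrun q.1.1 q.2)) := muOf_codeFP.comp ((hn.pair hc0).pair hS)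
  have h0 : CodeFP CE bitE (fun q => evalP q.1.2.1 []) := evalP_codeFP.comp (hc0.pair (const _ ([] : List Bool)))
  have h1 : CodeFP CE bitE (fun q => evalP q.1.2.2 (muOf q.1.1 q.1.2.1 (rrun q.1.1 q.2))) :=
    evalP_codeFP.comp (hc1.pair (bitsToStr.comp hmu))
  exact (h0.xor h1).not.congr fun _ => rfl

/-- **The decision on genuine instance codes** `⟨encode I, y⟩ ↦ accept find (instOf I) (encode I)` is computed in
polynomial time, for `find ∈ FP`. [cite: AroraBarak2009, §1.3] -/
theorem acceptI_codeFP {find : List Bool → List Bool} (hfind : find ∈ FP) :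
    CodeFP (pairE KForrelationInstance.encode strE) bitE (fun p => accept find (instOf p.1) p.1.encode) := by
  have hI : CodeFP (pairE KForrelationInstance.encode strE) KForrelationInstance.encode (fun p => p.1) := fst _ _
  have hx : CodeFP (pairE KForrelationInstance.encode strE) strE (fun p => p.1.encode) :=
    (transparent (eα := KForrelationInstance.encode) (eβ := strE) (g := fun I => I.encode) fun _ => rfl).comp hI
  have ht : CodeFP (pairE KForrelationInstance.encode strE) instE (fun p => instOf p.1) := instOf_codeFP.comp hI
  have hL1 : CodeFP (pairE KForrelationInstance.encode strE) unE (fun p => p.1.encode.length + 1) :=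
    unSucc.comp (strLength.comp hx)
  have hne : CodeFP (pairE KForrelationInstance.encode strE) unE (fun p => nEff (instOf p.1) p.1.encode.length) :=
    (unOfNatMin.comp (hL1.pair (instN_codeFP.comp ht))).congr fun _ => rfl
  have hc : ∀ i : ℕ, CodeFP (pairE KForrelationInstance.encode strE) pcE (fun p => circAt (instOf p.1) i) := fun i =>
    circAt_codeFP.comp (ht.pair (const _ i))
  have hrows : CodeFP (pairE KForrelationInstance.encode strE) (rawE strE) (fun p => decNil (find p.1.encode)) :=
    SumcheckMA.decNilC.comp ((of_fn (eα := strE) (eβ := strE) (g := find) find hfind fun _ => rfl).comp hx)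
  exact (acceptCore_codeFP.comp ((hne.pair ((hc 0).pair (hc 1))).pair hrows)).congr fun _ => rfl

/-! ### The `FP` witness -/

/-- A polynomial-time string function computing the decision on instance codes (by choice from `acceptI_codeFP`).
[cite: AroraBarak2009, §1.3] -/
def accF {find : List Bool → List Bool} (hfind : find ∈ FP) : List Bool → List Bool := Classical.choose (acceptI_codeFP hfind)

/-- `accF ∈ FP` and its value on instance codes. [cite: AroraBarak2009, §1.3] -/
theorem accF_spec {find : List Bool → List Bool} (hfind : find ∈ FP) :
    accF hfind ∈ FP ∧ ∀ (I : KForrelationInstance) (y : List Bool), accF hfind (boolPair I.encode y) = [accept find (instOf I) I.encode] :=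
  ⟨(Classical.choose_spec (acceptI_codeFP hfind)).1, fun I y => (Classical.choose_spec (acceptI_codeFP hfind)).2 (I, y)⟩

/-- **The decider**: `accF` normalised to one bit on every string (`[accF z = [true]]`). [cite: Goldreich2006, Def. 1.2] -/
def dec {find : List Bool → List Bool} (hfind : find ∈ FP) : List Bool → List Bool := eqPairFn ∘ fanoutFn (accF hfind) (fun _ => [true])

/-- **`dec ∈ FP`**, `dec` is one-bit, and `dec ⟨encode I, y⟩ = [accept find (instOf I) (encode I)]`. [cite: Goldreich2006, Def. 1.2] -/
theorem dec_spec {find : List Bool → List Bool} (hfind : find ∈ FP) :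
    dec hfind ∈ FP ∧ OneBit (dec hfind) ∧
      ∀ (I : KForrelationInstance) (y : List Bool), dec hfind (boolPair I.encode y) = [accept find (instOf I) I.encode] := by
  refine ⟨comp_mem_FP eqPairFn_mem_FP (fanoutFn_mem_FP (accF_spec hfind).1 (const_mem_FP _)), OneBit.comp oneBit_eqPairFn _,
    fun I y => ?_⟩
  rw [dec, Function.comp_apply, fanoutFn_apply, eqPairFn_boolPair, (accF_spec hfind).2]
  cases accept find (instOf I) I.encode <;> rfl

/-! ### Correctness on the promise -/

section Correct

open QuadSampler (bz bz_apply sgnZ sgnZ_eq_one_iff zmod2_eq_zero_or_one twist_eq_sgnZ signOf_eq_sgnZ toInput_map_range toInput_nil)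
open Literature.Computability.Complexity.F2Elim
open Literature.Computability.Complexity.BLR (toZ)

variable {n : ℕ}

/-- The finite set `V(L)`: the `𝔽₂`-row span of the rows `L`, read back as bit vectors (the literal term of the stub).
[folklore] -/
abbrev VL (n : ℕ) (L : List (List Bool)) : Finset (Fin n → Bool) :=
  @Finset.filter (Fin n → Bool) (fun v => (fun i => if v i then (1 : ZMod 2) else 0) ∈ rowSpan n L) (Classical.decPred _) Finset.univ

/-- Membership in `V(L)`: the `𝔽₂`-reading lies in the row span. [folklore] -/
theorem mem_VL_iff (L : List (List Bool)) (v : Fin n → Bool) : v ∈ VL n L ↔ bz v ∈ rowSpan n L := by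
  simp only [Finset.mem_filter, Finset.mem_univ, true_and]
  exact Iff.rfl

/-- `(-1)^{x·y} = 1 ↔ x · y = 0` in `𝔽₂`. [folklore] -/
theorem twist_eq_one_iff_dotZ (x y : Fin n → Bool) : twist x y = 1 ↔ dotZ (bz x) (bz y) = 0 := by
  rw [twist_eq_sgnZ, sgnZ_eq_one_iff]

/-- `sgnZ` is injective on `𝔽₂`. [folklore] -/
theorem sgnZ_injective : Function.Injective sgnZ := fun a b h => by
  rcases zmod2_eq_zero_or_one a with rfl | rfl <;> rcases zmod2_eq_zero_or_one b with rfl | rfl <;>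
    first | rfl | (exfalso; simp [sgnZ] at h; norm_num at h)

/-- **`V(L)^⊥` is the kernel of the rows**: `y` is orthogonal (under `(-1)^{v·y}`) to every vector of the row span iff
`r · y = 0` for every row `r`. [folklore] -/
theorem perp_iff_kerSet (L : List (List Bool)) (y : Fin n → Bool) :
    (∀ v ∈ VL n L, twist v y = 1) ↔ bz y ∈ kerSet n L := by
  constructor
  · intro h r hr
    have := h (toInput n r) ((mem_VL_iff L _).2 (vecZ_mem_rowSpan hr))
    rwa [twist_eq_one_iff_dotZ] at this
  · intro h v hv
    rw [twist_eq_one_iff_dotZ]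
    exact dotZ_eq_zero_of_mem_rowSpan ((mem_VL_iff L v).1 hv) h

/-- The slope bit of a genuine circuit code: `C(v) ⊕ C(0)`. [folklore] -/
theorem slopeBit_pcircOf (C : Circuit (Fin n)) (v : List Bool) :
    slopeBit (pcircOf C) v = (C.eval (toInput n v) ^^ C.eval zeroVec) := by
  rw [slopeBit, evalP_pcircOf_eq, evalP_pcircOf_eq, toInput_nil]; rfl

/-- **The slope vector solves the basis equations**: `x_c · μ = c₀(x_c) ⊕ c₀(0)` for every free column `c`
(`(x_c)_i = δ_{ci}` on free `i`, and `μ` vanishes on pivot columns). [cite: KnuthTAOCP2, §4.6.2 Algorithm N] -/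
theorem dotZ_kvec_muOf (C : Circuit (Fin n)) (L : List (List Bool)) {c : Fin n} (hc : isPiv (rrun n L) c = false) :
    dotZ (vecZ n (kvec n (rrun n L) c)) (bz (toInput n (muOf n (pcircOf C) (rrun n L)))) =
      toZ (slopeBit (pcircOf C) (kvec n (rrun n L) c)) := by
  rw [dotZ_comm, muOf, toInput_map_range]
  unfold dotZ
  simp_rw [bz_apply, vecZ_kvec hc]
  rw [Finset.sum_eq_single c (fun i _ hic => ?_) (fun h => absurd (Finset.mem_univ c) h)]
  · simp [hc]
  · rw [if_neg hic, zero_add]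
    cases h : isPiv (rrun n L) i <;> simp [Literature.Computability.Complexity.BLR.toZ]

/-- **Slope transfer.** If `c₀` is affine on `V(L)^⊥` with some slope `r` (`(-1)^{c₀ x}(-1)^{x·r} = (-1)^{c₀ 0}` on
`V(L)^⊥`), then the machine's slope vector `μ` has the same property: `V(L)^⊥ = ker L` is spanned by the kernel vectors
`x_c` (`c` free), both `μ` and `r` solve `x_c · μ = c₀(x_c) ⊕ c₀(0)`, and the pairing is bilinear.
[cite: KnuthTAOCP2, §4.6.2 Algorithm N] -/
theorem slope_muOf (C : Circuit (Fin n)) (L : List (List Bool)) {r : Fin n → Bool}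
    (hr : ∀ x ∈ (Finset.univ.filter fun y => ∀ v ∈ VL n L, twist v y = 1),
      signOf (C.eval (bxor zeroVec x)) * twist x r = signOf (C.eval zeroVec)) :
    ∀ x ∈ (Finset.univ.filter fun y => ∀ v ∈ VL n L, twist v y = 1),
      signOf (C.eval x) * twist x (toInput n (muOf n (pcircOf C) (rrun n L))) = signOf (C.eval zeroVec) := by
  intro x hx
  have hker : bz x ∈ kerSet n L := (perp_iff_kerSet L x).1 (Finset.mem_filter.1 hx).2
  have key : ∀ c ∈ frees n (rrun n L), dotZ (vecZ n (kvec n (rrun n L) c)) (bz (toInput n (muOf n (pcircOf C) (rrun n L)))) =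
      dotZ (vecZ n (kvec n (rrun n L) c)) (bz r) := by
    intro c hc
    have hcf := mem_frees.1 hc
    have hkP : toInput n (kvec n (rrun n L) c) ∈ Finset.univ.filter (fun y => ∀ v ∈ VL n L, twist v y = 1) :=
      Finset.mem_filter.2 ⟨Finset.mem_univ _, (perp_iff_kerSet L _).2 (vecZ_kvec_mem_kerSet hcf)⟩
    have h1 := hr _ hkP
    rw [BuzetChailloux.zeroVec_bxor] at h1
    have hsq := BuzetChailloux.signOf_sq (C.eval (toInput n (kvec n (rrun n L) c)))
    have h2 : twist (toInput n (kvec n (rrun n L) c)) r =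
        signOf (C.eval (toInput n (kvec n (rrun n L) c)) ^^ C.eval zeroVec) := by
      rw [signOf_xor]
      linear_combination (signOf (C.eval (toInput n (kvec n (rrun n L) c)))) * h1 - (twist (toInput n (kvec n (rrun n L) c)) r) * hsq
    rw [twist_eq_sgnZ, signOf_eq_sgnZ] at h2
    rw [dotZ_kvec_muOf C L hcf, slopeBit_pcircOf, ← sgnZ_injective h2]
    rfl
  have hdot : dotZ (bz x) (bz (toInput n (muOf n (pcircOf C) (rrun n L)))) = dotZ (bz x) (bz r) := by
    rw [eq_sum_kvec_of_mem_kerSet hker, dotZ_sum_left, dotZ_sum_left]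
    exact Finset.sum_congr rfl fun c hc => by rw [dotZ_smul_left, dotZ_smul_left, key c hc]
  have hrx := hr x hx
  rw [BuzetChailloux.zeroVec_bxor] at hrx
  rwa [twist_eq_sgnZ, hdot, ← twist_eq_sgnZ]

variable (I : KForrelationInstance) (hk : I.k = 2)

include hk in
/-- **Exactly forrelated instances satisfy the size guard**: two or more idle input wires would give `|Φ| ≤ 1/2`
(`ForrMem.value_eq`: each idle wire of a `2`-fold instance costs a factor `1/√2`), so `Φ = ±1` forces
`n ≤ #read wires + 1 ≤ |x| + 1`. [cite: AaronsonAmbainis2018, §3.2 and §6] -/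
theorem n_le_of_value (hv : I.value = 1 ∨ I.value = -1) : I.n ≤ I.encode.length + 1 := by
  -- adapted from `CubicDequant.guard_of_isYes`
  by_contra hlt
  push Not at hlt
  have hs := ForrMem.sR_le_length I
  have ht : 2 ≤ I.n - ForrMem.sR I := by omega
  have hval := ForrMem.value_eq I
  have hrho : idleFactor I.k = (Real.sqrt 2)⁻¹ := idleFactor_of_even (by rw [hk])
  have habs : |I.value| ≤ 1 / 2 := by
    rw [hval, abs_mul, abs_pow, hrho, abs_inv, abs_of_nonneg (Real.sqrt_nonneg 2)]
    have h1 : |ForrMem.phi0 I| ≤ 1 := abs_kForrelationValue_le_one _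
    have hr1 : (Real.sqrt 2)⁻¹ ≤ 1 := by
      rw [inv_le_one₀ (Real.sqrt_pos.2 two_pos)]
      exact Real.one_le_sqrt.2 (by norm_num)
    have hr0 : 0 ≤ (Real.sqrt 2)⁻¹ := by positivity
    have h2 : ((Real.sqrt 2)⁻¹) ^ (I.n - ForrMem.sR I) ≤ ((Real.sqrt 2)⁻¹) ^ 2 := pow_le_pow_of_le_one hr0 hr1 ht
    have hsq : ((Real.sqrt 2)⁻¹) ^ 2 = 1 / 2 := by rw [inv_pow, Real.sq_sqrt (by norm_num)]; norm_num
    calc |ForrMem.phi0 I| * (Real.sqrt 2)⁻¹ ^ (I.n - ForrMem.sR I) ≤ 1 * (1 / 2) := by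
          rw [← hsq]; exact mul_le_mul h1 h2 (by positivity) zero_le_one
      _ = 1 / 2 := one_mul _
  rcases hv with h | h <;> rw [h] at habs <;> norm_num at habs

/-- Under the guard and `find x = encList L`, the machine runs the core decision on `(n, C₀, C₁, L)`. [folklore] -/
theorem accept_eq_acceptCore (hn : I.n ≤ I.encode.length + 1) {find : List Bool → List Bool} {L : List (List Bool)}
    (hL : find I.encode = encList L) :
    accept find (instOf I) I.encode = acceptCore I.n (pcircOf (C₀ I hk)) (pcircOf (C₁ I hk)) L := by
  rw [accept, show nEff (instOf I) I.encode.length = I.n from min_eq_left hn, circAt_zero I hk, circAt_one I hk, hL,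
    decNil_encList]

/-- The core decision accepts iff `f(0) = g(μ)`. [folklore] -/
theorem acceptCore_eq_true_iff (L : List (List Bool)) :
    acceptCore I.n (pcircOf (C₀ I hk)) (pcircOf (C₁ I hk)) L = true ↔
      fI I hk zeroVec = gI I hk (toInput I.n (muOf I.n (pcircOf (C₀ I hk)) (rrun I.n L))) := by
  rw [acceptCore, evalP_pcircOf_eq, evalP_pcircOf_eq, toInput_nil]
  show (!(fI I hk zeroVec ^^ gI I hk _)) = true ↔ _
  cases fI I hk zeroVec <;> cases gI I hk _ <;> simp

include hk in
/-- **Correctness of the decision on the promise.** Given the finder's output `L` (an M-subspace `V(L)` of `g`), the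
sign readout, and `Φ = ±1`: `accept = true ↔ Φ = 1`. The slope of `f` on `V(L)^⊥` exists by
`DerivativeWalsh.dual_affine_on_perp_cosets` (at `x₀ = 0`) and is transferred to the machine's `μ` by `slope_muOf`;
the readout gives `Φ = (-1)^{f 0}(-1)^{g μ}`. [cite: Carlet2020, Prop. 77] [cite: AaronsonAmbainis2018, §1.1.1] -/
theorem accept_eq_true_iff {find : List Bool → List Bool} {L : List (List Bool)} (hL : find I.encode = encList L)
    (hV : (zeroVec ∈ VL I.n L ∧ ∀ x ∈ VL I.n L, ∀ y ∈ VL I.n L, bxor x y ∈ VL I.n L) ∧ (((VL I.n L).card : ℝ) ^ 2 = (2 : ℝ) ^ I.n) ∧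
      (∀ u ∈ VL I.n L, ∀ v ∈ VL I.n L, ∀ x, (gI I hk x ^^ gI I hk (bxor x u) ^^ gI I hk (bxor x v) ^^ gI I hk (bxor x (bxor u v))) = false))
    (hread : ∀ (n : ℕ) (a b : (Fin n → Bool) → Bool) (V : Finset (Fin n → Bool)) (μ : Fin n → Bool),
      (forrelation a b = 1 ∨ forrelation a b = -1) →
      ((zeroVec ∈ V ∧ ∀ x ∈ V, ∀ y ∈ V, bxor x y ∈ V) ∧ (((V).card : ℝ) ^ 2 = (2 : ℝ) ^ (n)) ∧
        (∀ u ∈ V, ∀ v ∈ V, ∀ x, (b x ^^ b (bxor x u) ^^ b (bxor x v) ^^ b (bxor x (bxor u v))) = false)) →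
      (∀ x ∈ (Finset.univ.filter fun y => ∀ v ∈ V, twist v y = 1), signOf (a x) * twist x μ = signOf (a zeroVec)) →
      forrelation a b = signOf (a zeroVec) * signOf (b μ))
    (hv : I.value = 1 ∨ I.value = -1) : accept find (instOf I) I.encode = true ↔ I.value = 1 := by
  obtain ⟨⟨h0, hadd⟩, hcard, hM⟩ := hV
  have hΦ : forrelation (fI I hk) (gI I hk) = 1 ∨ forrelation (fI I hk) (gI I hk) = -1 := by
    rwa [value_eq_forrelation_fg I hk] at hv
  obtain ⟨r, hr⟩ := DerivativeWalsh.dual_affine_on_perp_cosets hΦ h0 hadd hcard hM zeroVec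
  have hΦeq := hread I.n (fI I hk) (gI I hk) (VL I.n L) _ hΦ ⟨⟨h0, hadd⟩, hcard, hM⟩ (slope_muOf (C₀ I hk) L hr)
  rw [accept_eq_acceptCore I hk (n_le_of_value I hk hv) hL, acceptCore_eq_true_iff, value_eq_forrelation_fg I hk, hΦeq]
  cases fI I hk zeroVec <;> cases gI I hk _ <;> simp [signOf] <;> norm_num

end Correct

end Plumbing

open Plumbing in
/-- **Stub `stub_plumbing`** (line `dual-pingpong-frame`, crux `SignedExactCubicForrelationNotPrBPP`): a polynomial-time
finder of an M-subspace of `g` for every exact cubic pair (first hypothesis, `PairFinderExact`) and the sign readout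
(second hypothesis, `SignReadout`) put the signed exact slice of cubic `2`-fold Forrelation into `PromiseBPP'`.
THE MACHINE (`Plumbing.accept`, deterministic, coins unread) on `⟨x, y⟩`: rows `L := decNil (find x)`, Gaussian
elimination over `𝔽₂` (`F2Elim.rrun`), slope vector `μ` (`Plumbing.muOf`: `μ_c = f(x_c) ⊕ f(0)` at the free columns `c`,
`x_c` the kernel vectors), accept iff `f(0) = g(μ)`; it is `FP` on all inputs (`acceptI_codeFP`, effective dimension
`min n (|x|+1)`, which is `n` on the promise since `Φ = ±1` leaves at most one idle wire, `n_le_of_value`). CORRECTNESS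
(`accept_eq_true_iff`): McFarland duality `DerivativeWalsh.dual_affine_on_perp_cosets` gives a slope of `f` on `V(L)^⊥`,
`slope_muOf` transfers it to `μ`, the readout gives `Φ = (-1)^{f 0}(-1)^{g μ}`; so yes-codes are accepted and no-codes
rejected for EVERY coin string, and `PromiseProblem.mem_PromiseBPP'_of_fp_decider` concludes.
[cite: Goldreich2006, Def. 1.2] [cite: AaronsonAmbainis2018, §1.1.1] [cite: Carlet2020, Prop. 77] -/
theorem stub_plumbing :
    (∃ find ∈ FP, ∀ (I : KForrelationInstance) (hk : I.k = 2), Even I.n → I.IsOverB2 →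
    (∀ i, IsDegLeFun 3 (I.C i).eval) → (I.value = 1 ∨ I.value = -1) →
    ∃ L : List (List Bool), find I.encode = encList L ∧
      ((zeroVec ∈ (@Finset.filter (Fin (I.n) → Bool) (fun v => (fun i => if v i then (1 : ZMod 2) else 0) ∈ F2Elim.rowSpan (I.n) L) (Classical.decPred _) Finset.univ) ∧ ∀ x ∈ (@Finset.filter (Fin (I.n) → Bool) (fun v => (fun i => if v i then (1 : ZMod 2) else 0) ∈ F2Elim.rowSpan (I.n) L) (Classical.decPred _) Finset.univ), ∀ y ∈ (@Finset.filter (Fin (I.n) → Bool) (fun v => (fun i => if v i then (1 : ZMod 2) else 0) ∈ F2Elim.rowSpan (I.n) L) (Classical.decPred _) Finset.univ), bxor x y ∈ (@Finset.filter (Fin (I.n) → Bool) (fun v => (fun i => if v i then (1 : ZMod 2) else 0) ∈ F2Elim.rowSpan (I.n) L) (Classical.decPred _) Finset.univ)) ∧ ((((@Finset.filter (Fin (I.n) → Bool) (fun v => (fun i => if v i then (1 : ZMod 2) else 0) ∈ F2Elim.rowSpan (I.n) L) (Classical.decPred _) Finset.univ)).card : ℝ) ^ 2 = (2 : ℝ)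 ^ (I.n)) ∧ (∀ u ∈ (@Finset.filter (Fin (I.n) → Bool) (fun v => (fun i => if v i then (1 : ZMod 2) else 0) ∈ F2Elim.rowSpan (I.n) L) (Classical.decPred _) Finset.univ), ∀ v ∈ (@Finset.filter (Fin (I.n) → Bool) (fun v => (fun i => if v i then (1 : ZMod 2) else 0) ∈ F2Elim.rowSpan (I.n) L) (Classical.decPred _) Finset.univ), ∀ x, ((I.C (Fin.cast hk.symm 1)).eval x ^^ (I.C (Fin.cast hk.symm 1)).eval (bxor x u) ^^ (I.C (Fin.cast hk.symm 1)).eval (bxor x v) ^^ (I.C (Fin.cast hk.symm 1)).eval (bxor x (bxor u v))) = false))) →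
    (∀ (n : ℕ) (a b : (Fin n → Bool) → Bool) (V : Finset (Fin n → Bool)) (μ : Fin n → Bool),
    (forrelation a b = 1 ∨ forrelation a b = -1) →
    ((zeroVec ∈ V ∧ ∀ x ∈ V, ∀ y ∈ V, bxor x y ∈ V) ∧ (((V).card : ℝ) ^ 2 = (2 : ℝ) ^ (n)) ∧ (∀ u ∈ V, ∀ v ∈ V, ∀ x, (b x ^^ b (bxor x u) ^^ b (bxor x v) ^^ b (bxor x (bxor u v))) = false)) →
    (∀ x ∈ (Finset.univ.filter fun y => ∀ v ∈ V, twist v y = 1), signOf (a x) * twist x μ = signOf (a zeroVec)) →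
    forrelation a b = signOf (a zeroVec) * signOf (b μ)) →
    signedExactCubicForrelationProblem 2 ∈ PromiseBPP' := by
  rintro ⟨find, hfind, hfinder⟩ hread
  obtain ⟨hdecFP, hdec1, hdecI⟩ := dec_spec hfind
  have key : ∀ I : KForrelationInstance, I.IsOverB2 → (I.value = 1 ∨ I.value = -1) → I.k = 2 → Even I.n →
      (∀ i, IsDegLeFun 3 (I.C i).eval) → (accept find (ForrCode.instOf I) I.encode = true ↔ I.value = 1) := by
    intro I hB2 hv hk heven hdeg
    obtain ⟨L, hL, hV⟩ := hfinder I hk heven hB2 hdeg hv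
    exact accept_eq_true_iff I hk hL hV hread hv
  refine (signedExactCubicForrelationProblem 2).mem_PromiseBPP'_of_fp_decider hdecFP hdec1 0 ?_ ?_
  · rintro x ⟨I, ⟨hB2, hval, hk, heven, hdeg⟩, rfl⟩
    have hacc : accept find (ForrCode.instOf I) I.encode = true := (key I hB2 (Or.inl hval) hk heven hdeg).2 hval
    rw [Set.eq_univ_of_forall (s := {y | dec hfind (boolPair I.encode y) = [true]}) fun y => by
      show dec hfind (boolPair I.encode y) = [true]; rw [hdecI, hacc], uniformProb_univ]
    norm_num
  · rintro x ⟨I, ⟨hB2, hval, hk, heven, hdeg⟩, rfl⟩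
    have hacc : accept find (ForrCode.instOf I) I.encode = false := by
      have h := key I hB2 (Or.inr hval) hk heven hdeg
      rw [hval] at h
      cases hacc : accept find (ForrCode.instOf I) I.encode
      · rfl
      · exact absurd (h.1 hacc) (by norm_num)
    rw [Set.eq_univ_of_forall (s := {y | dec hfind (boolPair I.encode y) = [false]}) fun y => by
      show dec hfind (boolPair I.encode y) = [false]; rw [hdecI, hacc], uniformProb_univ]
    norm_num

end Summit.QuantumAdvantage.QuantumAdvantage.Theorems.SignedExactCubicForrelationNotPrBPP

end
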